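import Mathlib
import Summits.NavierStokesRegularity.NavierStokesRegularity.Theorems.FrozenSignCascadeEnvelopeBoundShellKernel
import Summits.NavierStokesRegularity.NavierStokesRegularity.Theorems.FrozenSignCascadeEnvelopeBoundSmallData
import Summits.NavierStokesRegularity.NavierStokesRegularity.Theorems.FrozenSignCascadeEnvelopeBoundReduction
import HarnessLib

/-!
# Route FrozenSignCascade · crux `EnvelopeBound` (stmt-NavierStokesRegularity-1549): frequency
  localisation, II — smallness on one bounded shell gives the full envelope bound

Support file for the crux item stmt-NavierStokesRegularity-1549 (`EnvelopeBound`); lands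
`--supports` that item (line `registered`, support sub-goal `envelopeBound_of_shellSmallness`; the
shell-to-tail bootstrap is in the companion file `FrozenSignCascadeEnvelopeBoundShellKernel`).

**Theorem (`envelopeBound_of_shellSmallness`).** There is an absolute `κ > 0`
(`κ = π / (1728 · 3|B₁|) = 1/6912`) such that for every viscosity `ν > 0`, Clay datum `u₀`,
horizon `T₀ > 0` and radius `R ≥ 1` there are `R' ≥ R` and `C`, depending on `(ν, u₀, T₀, R)`
only, with the following property: along EVERY Fourier-side mild solution `V` on `[0,T]`,
`T ≤ T₀`, from the Fourier datum `a = fourierData hu hd`, smallness of the critical envelope on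
the single bounded shell `R ≤ ‖ξ‖ ≤ R'`, `‖ξ‖² ‖V(t,ξ)‖ ≤ κν`, implies the full envelope bound
`‖ξ‖² ‖V(t,ξ)‖ ≤ C` on `[0,T] × ℝ³`. So the open content of the crux (a large-data critical
a-priori bound) lives on one bounded frequency shell: below it the energy level owns the
envelope (`Registered.lowFrequencyControl`), beyond it the tightness of the datum propagates by a
magnitude-only bootstrap fed by the shell.

Proof.
* `shell_trapping`: continuous induction on `[0,T]`
  (`IsClosed.Icc_subset_of_forall_mem_nhdsGT_of_Icc_subset`) for the closed set of times at which
  the envelope beyond `R'` is `≤ ε` (`ε = κν`): past such a time it stays `≤ 2ε` for a short while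
  (uniform order-`3` decay at very high frequencies; joint continuity and
  `IsCompact.eventually_forall_of_forall_eventually` on a compact annulus), the shell hypothesis
  supplies `≤ ε ≤ 2ε` on `R ≤ ‖ζ‖ ≤ R'`, and the bootstrap of the companion file
  (`shell_bootstrap`) with `Φ = 2ε` returns `≤ ε/4 + ε/4 + ε/2` once `2304π M |B_R| ≤ c R'` and
  `6912π · 3|B₁| · ε ≤ c`.
* `envelopeBound_of_shellSmallness`: `M = A₀ + 36πRΛT₀` bounds `‖V(s,ζ)‖` on `‖ζ‖ < R` by the
  energy inequality (`Registered.energyIneq`, `TightEnvelope.norm_le_of_energy`), the datum's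
  order-`3` decay makes its envelope `≤ ε/4` beyond `R' ≥ 4A₃/ε`, and below `R'` the bound is
  `Registered.lowFrequencyControl`.

References: Y. Le Jan, A.-S. Sznitman, PTRF 109 (1997); P. G. Lemarié-Rieusset, *The
Navier–Stokes problem in the 21st century* (2016), §8.5, Thm. 8.19 / 8.21.
-/

noncomputable section

set_option linter.dupNamespace false -- nested layout Summit.<S>.<Sub>, Sub = S (D-0017)

open MeasureTheory Set Metric Real Filter Topology
open Literature.Analysis.FluidPDE Literature.Analysis.FluidPDE.FourierNS
open Summit.NavierStokesRegularity.NavierStokesRegularity.Theorems.TightEnvelope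

namespace Summit.NavierStokesRegularity.NavierStokesRegularity.Theorems.EnvelopeBound.Registered

/-! ### Trapping beyond the shell -/

variable {c T : ℝ} {V : ℝ → EuclideanSpace ℝ (Fin 3) → Fin 3 → ℂ}

/-- **Trapping beyond the shell.** For a Fourier-side mild solution on `[0,T]` with
`‖V(s,ζ)‖ ≤ M` on `‖ζ‖ < R` (`R > 0`), shell smallness `‖ζ‖²‖V(s,ζ)‖ ≤ ε` on `R ≤ ‖ζ‖ ≤ R'`
(`R' ≥ 2R`), a datum tail `‖ξ‖²‖V(0,ξ)‖ ≤ ε/4` beyond `R'`, and the two size conditions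
`2304π M |B_R| ≤ c R'`, `6912π · 3|B₁| · ε ≤ c`, the envelope stays `≤ ε` beyond `R'` on `[0,T]`.
Continuous induction (`IsClosed.Icc_subset_of_forall_mem_nhdsGT_of_Icc_subset`) on the closed set
`{t | ∀ ‖ξ‖ ≥ R', ‖ξ‖²‖V(t,ξ)‖ ≤ ε}`: past a good time `x < T` the envelope beyond `R'` stays
`≤ 2ε` for a short while (uniform order-`3` decay at ‖ξ‖ ≥ ρ; joint continuity and
`IsCompact.eventually_forall_of_forall_eventually` on the compact annulus `R' ≤ ‖ξ‖ ≤ ρ`), so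
`Φ = 2ε` is an envelope on `‖ζ‖ ≥ R` over `[0,t]`, and `shell_bootstrap` returns
`≤ ε/4 + ε/4 + ε/2 = ε`. -/
theorem shell_trapping (h : IsFourierMild c 4 0 T V) {M ε R R' : ℝ} (hR : 0 < R)
    (hRR' : 2 * R ≤ R') (hM0 : 0 ≤ M) (hε : 0 < ε)
    (hM : ∀ s ∈ Icc 0 T, ∀ ζ : EuclideanSpace ℝ (Fin 3), ‖ζ‖ < R → ‖V s ζ‖ ≤ M)
    (hshell : ∀ s ∈ Icc 0 T, ∀ ζ : EuclideanSpace ℝ (Fin 3), R ≤ ‖ζ‖ → ‖ζ‖ ≤ R' →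
      ‖ζ‖ ^ 2 * ‖V s ζ‖ ≤ ε)
    (hdat : ∀ ξ : EuclideanSpace ℝ (Fin 3), R' ≤ ‖ξ‖ → ‖ξ‖ ^ 2 * ‖V 0 ξ‖ ≤ ε / 4)
    (hR' : 2304 * π * M * (volume (ball (0 : EuclideanSpace ℝ (Fin 3)) R)).toReal ≤ c * R')
    (hεc : 6912 * π * (3 * (volume (ball (0 : EuclideanSpace ℝ (Fin 3)) 1)).toReal) * ε ≤ c) :
    ∀ t ∈ Icc 0 T, ∀ ξ : EuclideanSpace ℝ (Fin 3), R' ≤ ‖ξ‖ → ‖ξ‖ ^ 2 * ‖V t ξ‖ ≤ ε := by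
  have hc := h.hc
  have hR'0 : 0 < R' := by linarith
  set vB : ℝ := (volume (ball (0 : EuclideanSpace ℝ (Fin 3)) R)).toReal with hvB
  set CE : ℝ := 3 * (volume (ball (0 : EuclideanSpace ℝ (Fin 3)) 1)).toReal with hCE
  set U : ℝ := 2 * ε with hU
  have hU0 : 0 < U := by positivity
  have hεU : ε < U := by rw [hU]; linarith
  -- the closed set of good times
  obtain ⟨S, hS⟩ : ∃ S : Set ℝ, ∀ t, t ∈ S ↔
      ∀ ξ : EuclideanSpace ℝ (Fin 3), R' ≤ ‖ξ‖ → ‖ξ‖ ^ 2 * ‖V t ξ‖ ≤ ε :=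
    ⟨{t | ∀ ξ : EuclideanSpace ℝ (Fin 3), R' ≤ ‖ξ‖ → ‖ξ‖ ^ 2 * ‖V t ξ‖ ≤ ε}, fun _ => Iff.rfl⟩
  have hSc : IsClosed S := by
    have e : S = ⋂ ξ ∈ {ξ : EuclideanSpace ℝ (Fin 3) | R' ≤ ‖ξ‖},
        {t : ℝ | ‖ξ‖ ^ 2 * ‖V t ξ‖ ≤ ε} := by
      ext t
      simp only [hS, mem_iInter, mem_setOf_eq]
    rw [e]
    exact isClosed_biInter fun ξ _ =>
      isClosed_le (continuous_const.mul (h.continuous_time ξ).norm) continuous_const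
  suffices hsub : Icc 0 T ⊆ S from fun t ht => (hS t).1 (hsub ht)
  have h0S : (0 : ℝ) ∈ S := (hS 0).2 fun ξ hξ => (hdat ξ hξ).trans (by linarith)
  refine (hSc.inter isClosed_Icc).Icc_subset_of_forall_mem_nhdsGT_of_Icc_subset h0S ?_
  rintro x ⟨hx0, hxT⟩ hhist
  have hpast : ∀ s ∈ Icc 0 x, ∀ ξ : EuclideanSpace ℝ (Fin 3), R' ≤ ‖ξ‖ →
      ‖ξ‖ ^ 2 * ‖V s ξ‖ ≤ ε := fun s hs => (hS s).1 (hhist hs)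
  -- (a) very high frequencies: the uniform order-`3` decay
  obtain ⟨A3, hA3⟩ := h.decay 3
  have hA30 : 0 ≤ A3 := (hA3 0).nonneg
  set ρ : ℝ := A3 / U with hρ
  have htail : ∀ t (ξ : EuclideanSpace ℝ (Fin 3)), ρ ≤ ‖ξ‖ → ‖ξ‖ ^ 2 * ‖V t ξ‖ ≤ U := by
    intro t ξ hξ
    have hn0 : 0 ≤ ‖ξ‖ := norm_nonneg ξ
    have h1 : (1 + ‖ξ‖) ^ 3 * ‖V t ξ‖ ≤ A3 := weight_mul_norm_le (hA3 t) ξ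
    have h2' : ‖ξ‖ ^ 2 * (1 + ‖ξ‖) ≤ (1 + ‖ξ‖) ^ 3 := by
      have := mul_le_mul_of_nonneg_right
        (pow_le_pow_left₀ hn0 (by linarith : ‖ξ‖ ≤ 1 + ‖ξ‖) 2) (by positivity : (0 : ℝ) ≤ 1 + ‖ξ‖)
      calc ‖ξ‖ ^ 2 * (1 + ‖ξ‖) ≤ (1 + ‖ξ‖) ^ 2 * (1 + ‖ξ‖) := this
        _ = (1 + ‖ξ‖) ^ 3 := by ring
    have h2 : ‖ξ‖ ^ 2 * ‖V t ξ‖ * (1 + ‖ξ‖) ≤ A3 :=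
      calc ‖ξ‖ ^ 2 * ‖V t ξ‖ * (1 + ‖ξ‖) = ‖ξ‖ ^ 2 * (1 + ‖ξ‖) * ‖V t ξ‖ := by ring
        _ ≤ (1 + ‖ξ‖) ^ 3 * ‖V t ξ‖ := mul_le_mul_of_nonneg_right h2' (norm_nonneg _)
        _ ≤ A3 := h1
    have h3 : A3 ≤ U * (1 + ‖ξ‖) :=
      calc A3 = U * ρ := by rw [hρ]; field_simp
        _ ≤ U * ‖ξ‖ := mul_le_mul_of_nonneg_left hξ hU0.le
        _ ≤ U * (1 + ‖ξ‖) := mul_le_mul_of_nonneg_left (by linarith) hU0.le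
    exact le_of_mul_le_mul_right (h2.trans h3) (by positivity)
  -- (b) the compact annulus `R' ≤ ‖ξ‖ ≤ ρ`: joint continuity, at time `x` the envelope is `< U`
  have hV' : Continuous fun p : ℝ × EuclideanSpace ℝ (Fin 3) => V p.1 p.2 := h.cont
  have hcont : Continuous fun p : ℝ × EuclideanSpace ℝ (Fin 3) => ‖p.2‖ ^ 2 * ‖V p.1 p.2‖ :=
    (continuous_snd.norm.pow 2).mul hV'.norm
  have hK : IsCompact (closedBall (0 : EuclideanSpace ℝ (Fin 3)) ρ ∩
      {ξ : EuclideanSpace ℝ (Fin 3) | R' ≤ ‖ξ‖}) :=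
    (isCompact_closedBall _ _).inter_right (isClosed_le continuous_const continuous_norm)
  have hev : ∀ᶠ t in 𝓝 x, ∀ ξ ∈ closedBall (0 : EuclideanSpace ℝ (Fin 3)) ρ ∩
      {ξ : EuclideanSpace ℝ (Fin 3) | R' ≤ ‖ξ‖}, ‖ξ‖ ^ 2 * ‖V t ξ‖ < U := by
    refine hK.eventually_forall_of_forall_eventually
      (P := fun t ξ => ‖ξ‖ ^ 2 * ‖V t ξ‖ < U) fun ξ hξ => ?_
    have hlt : ‖ξ‖ ^ 2 * ‖V x ξ‖ < U := (hpast x ⟨hx0, le_rfl⟩ ξ hξ.2).trans_lt hεU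
    exact (hcont.tendsto (x, ξ)).eventually_lt_const hlt
  have hev' : ∀ᶠ t in 𝓝 x, ∀ ξ : EuclideanSpace ℝ (Fin 3), R' ≤ ‖ξ‖ →
      ‖ξ‖ ^ 2 * ‖V t ξ‖ ≤ U :=
    hev.mono fun t ht ξ hξ => by
      rcases le_or_gt ρ ‖ξ‖ with h1 | h1
      · exact htail t ξ h1
      · exact (ht ξ ⟨mem_closedBall_zero_iff.2 h1.le, hξ⟩).le
  obtain ⟨θ, hθ0, hθ⟩ := Metric.eventually_nhds_iff.1 hev'
  -- the right neighbourhood `(x, min T (x + θ))` of `x` lies in `S`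
  refine (mem_nhdsGT_iff_exists_Ioo_subset' hxT).2 ⟨min T (x + θ), lt_min hxT (by linarith), ?_⟩
  intro t ht
  obtain ⟨hxt, htm⟩ := ht
  have htT : t < T := htm.trans_le (min_le_left _ _)
  have htθ : t < x + θ := htm.trans_le (min_le_right _ _)
  have ht0 : 0 ≤ t := hx0.trans hxt.le
  -- every value of the envelope beyond `R'` on `[0, t]` is `≤ U`
  have hallU : ∀ s ∈ Icc 0 t, ∀ ξ : EuclideanSpace ℝ (Fin 3), R' ≤ ‖ξ‖ →
      ‖ξ‖ ^ 2 * ‖V s ξ‖ ≤ U := by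
    intro s hs ξ hξ
    rcases le_or_gt s x with h1 | h1
    · exact (hpast s ⟨hs.1, h1⟩ ξ hξ).trans hεU.le
    · refine hθ ?_ ξ hξ
      rw [Real.dist_eq, abs_of_pos (by linarith)]
      linarith [hs.2]
  -- with the shell: `U` is an envelope on `‖ζ‖ ≥ R` over `[0, t]`
  have hΦ : ∀ s ∈ Icc 0 t, ∀ ζ : EuclideanSpace ℝ (Fin 3), R ≤ ‖ζ‖ →
      ‖ζ‖ ^ 2 * ‖V s ζ‖ ≤ U := by
    intro s hs ζ hζ
    rcases le_or_gt R' ‖ζ‖ with h1 | h1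
    · exact hallU s hs ζ h1
    · exact (hshell s ⟨hs.1, hs.2.trans htT.le⟩ ζ hζ h1.le).trans hεU.le
  have hM' : ∀ s ∈ Icc 0 t, ∀ ζ : EuclideanSpace ℝ (Fin 3), ‖ζ‖ < R → ‖V s ζ‖ ≤ M :=
    fun s hs => hM s ⟨hs.1, hs.2.trans htT.le⟩
  -- the bootstrap at time `t`
  refine (hS t).2 fun ξ hξ => ?_
  have hξ2R : 2 * R ≤ ‖ξ‖ := hRR'.trans hξ
  have hξ0 : 0 < ‖ξ‖ := hR'0.trans_le hξ
  have hb := shell_bootstrap h ⟨ht0, htT.le⟩ hR hM0 hU0.le hM' hΦ hξ2R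
  have t1 : ‖ξ‖ ^ 2 * ‖V 0 ξ‖ ≤ ε / 4 := hdat ξ hξ
  have hcξ : 2304 * π * M * vB ≤ c * ‖ξ‖ :=
    hR'.trans (mul_le_mul_of_nonneg_left hξ hc.le)
  have t2 : 36 * π / c * (8 * M * U * vB * ‖ξ‖⁻¹) ≤ ε / 4 := by
    rw [hU, div_mul_eq_mul_div, div_le_div_iff₀ hc (by norm_num : (0 : ℝ) < 4)]
    calc 36 * π * (8 * M * (2 * ε) * vB * ‖ξ‖⁻¹) * 4 = (2304 * π * M * vB) * ε * ‖ξ‖⁻¹ := by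
          ring
      _ ≤ (c * ‖ξ‖) * ε * ‖ξ‖⁻¹ := by gcongr
      _ = ε * c := by field_simp
  have t3 : 36 * π / c * (24 * U ^ 2 * CE) ≤ ε / 2 := by
    rw [hU, div_mul_eq_mul_div, div_le_div_iff₀ hc (by norm_num : (0 : ℝ) < 2)]
    calc 36 * π * (24 * (2 * ε) ^ 2 * CE) * 2 = ε * (6912 * π * CE * ε) := by ring
      _ ≤ ε * c := by gcongr
  calc ‖ξ‖ ^ 2 * ‖V t ξ‖ ≤ _ := hb
    _ = ‖ξ‖ ^ 2 * ‖V 0 ξ‖ + 36 * π / c * (8 * M * U * vB * ‖ξ‖⁻¹) +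
          36 * π / c * (24 * U ^ 2 * CE) := by ring
    _ ≤ ε / 4 + ε / 4 + ε / 2 := by gcongr
    _ = ε := by ring

/-! ### The registered support sub-goal -/

/-- **Frequency localisation of the crux `EnvelopeBound`.** There is an absolute `κ > 0`
(`κ = π / (1728 · 3|B₁|) = 1/6912`) such that for every `ν > 0`, Clay datum `u₀`, horizon `T₀ > 0`
and radius `R ≥ 1` there are `R' ≥ R` and `C` (depending on `ν, u₀, T₀, R` only) with: along
EVERY Fourier-side mild solution `V` on `[0,T]`, `T ≤ T₀`, from the Fourier datum, smallness
`‖ξ‖² ‖V(t,ξ)‖ ≤ κν` of the critical envelope on the ONE bounded shell `R ≤ ‖ξ‖ ≤ R'` implies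
`‖ξ‖² ‖V(t,ξ)‖ ≤ C` everywhere on `[0,T] × ℝ³`. With `c = 4π²ν`, `ε = κν`, `a = fourierData hu hd`,
`Λ = ∫∑ₗ‖aₗ‖²`, `‖a‖ ≤ A₀`, `(1+‖ξ‖)³‖a(ξ)‖ ≤ A₃`, `M = A₀ + 36πRΛT₀`:
`R' = max (2R) (max (4A₃/ε) (2304π M |B_R| / c))`, `C = max C_low(R') ε`; `‖V(s,ζ)‖ ≤ M` on
`‖ζ‖ < R` by `energyIneq` and `TightEnvelope.norm_le_of_energy`, beyond `R'` by `shell_trapping`,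
below `R'` by `lowFrequencyControl`. -/
theorem envelopeBound_of_shellSmallness :
    ∃ κ : ℝ, 0 < κ ∧ ∀ ν : ℝ, 0 < ν →
      ∀ (u₀ : EuclideanSpace ℝ (Fin 3) → EuclideanSpace ℝ (Fin 3)) (hu : ContDiff ℝ (⊤ : ℕ∞) u₀)
        (hd : Literature.Analysis.FluidPDE.HasRapidSpatialDecay u₀),
        Literature.Analysis.FluidPDE.NSWave0.IsDivFree u₀ →
      ∀ T₀ : ℝ, 0 < T₀ → ∀ R : ℝ, 1 ≤ R → ∃ R' C : ℝ, R ≤ R' ∧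
        ∀ T : ℝ, T ≤ T₀ → ∀ V : ℝ → EuclideanSpace ℝ (Fin 3) → Fin 3 → ℂ,
          Literature.Analysis.FluidPDE.FourierNS.IsFourierMild (4 * Real.pi ^ 2 * ν) 4 0 T V →
          V 0 = Literature.Analysis.FluidPDE.FourierNS.fourierData hu hd →
          (∀ t ∈ Set.Icc 0 T, ∀ ξ : EuclideanSpace ℝ (Fin 3), R ≤ ‖ξ‖ → ‖ξ‖ ≤ R' →
              ‖ξ‖ ^ 2 * ‖V t ξ‖ ≤ κ * ν) →
          ∀ t ∈ Set.Icc 0 T, ∀ ξ : EuclideanSpace ℝ (Fin 3), ‖ξ‖ ^ 2 * ‖V t ξ‖ ≤ C := by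
  set CE : ℝ := 3 * (volume (ball (0 : EuclideanSpace ℝ (Fin 3)) 1)).toReal with hCE
  have hCE0 : 0 < CE := three_mul_volume_ball_toReal_pos
  refine ⟨π / (1728 * CE), by positivity, ?_⟩
  intro ν hν u₀ hu hd hdiv T₀ hT₀ R hR
  have hR0 : 0 < R := by linarith
  set c : ℝ := 4 * Real.pi ^ 2 * ν with hc
  have hc0 : 0 < c := by positivity
  set ε : ℝ := π / (1728 * CE) * ν with hε
  have hε0 : 0 < ε := by positivity
  have hεc : 6912 * π * CE * ε ≤ c := by
    have e : 6912 * π * CE * ε = c := by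
      rw [hε, hc]
      field_simp
      ring
    exact e.le
  -- the datum: sup bound, order-`3` decay, energy
  obtain ⟨A₀, hA₀⟩ := hasDecay_fourierData hu hd 0
  obtain ⟨A₃, hA₃⟩ := hasDecay_fourierData hu hd 3
  have hA₀0 : 0 ≤ A₀ := hA₀.nonneg
  have hA₃0 : 0 ≤ A₃ := hA₃.nonneg
  set Λ : ℝ := ∫ η, ∑ l, ‖fourierData hu hd η l‖ ^ 2 with hΛ
  have hΛ0 : 0 ≤ Λ := integral_nonneg fun η => Finset.sum_nonneg fun l _ => sq_nonneg _
  set M : ℝ := A₀ + 36 * π * R * Λ * T₀ with hM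
  have hM0 : 0 ≤ M := by positivity
  set vB : ℝ := (volume (ball (0 : EuclideanSpace ℝ (Fin 3)) R)).toReal with hvB
  have hvB0 : 0 ≤ vB := ENNReal.toReal_nonneg
  -- the outer radius of the shell
  set R' : ℝ := max (2 * R) (max (4 * A₃ / ε) (2304 * π * M * vB / c)) with hR'
  have hR'2R : 2 * R ≤ R' := le_max_left _ _
  have hR'₁ : 4 * A₃ / ε ≤ R' := (le_max_left _ _).trans (le_max_right _ _)
  have hR'₂ : 2304 * π * M * vB / c ≤ R' := (le_max_right _ _).trans (le_max_right _ _)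
  have hR'0 : 0 < R' := by linarith
  have hR'c : 2304 * π * M * vB ≤ c * R' := by
    rw [mul_comm c]
    exact (div_le_iff₀ hc0).1 hR'₂
  obtain ⟨Clo, hlo⟩ := lowFrequencyControl ν hν u₀ hu hd hdiv T₀ hT₀ R'
  refine ⟨R', max Clo ε, by linarith, ?_⟩
  intro T hT V hV hV0 hshell
  -- below `R'`: the energy level; beyond `R'`: trapping
  suffices hhigh : ∀ t ∈ Icc 0 T, ∀ ξ : EuclideanSpace ℝ (Fin 3), R' ≤ ‖ξ‖ →
      ‖ξ‖ ^ 2 * ‖V t ξ‖ ≤ ε by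
    intro t ht ξ
    rcases le_total ‖ξ‖ R' with h1 | h1
    · exact (hlo T hT V hV hV0 t ht ξ h1).trans (le_max_left _ _)
    · exact (hhigh t ht ξ h1).trans (le_max_right _ _)
  -- the energy in the sup norm on `ℂ³` stays below `Λ`
  have hE' : ∀ r ∈ Icc 0 T, ∫ η, ‖V r η‖ ^ 2 ≤ Λ := by
    intro r hr
    have hE := energyIneq _ _ _ _ V hV r hr
    rw [hV0] at hE
    refine le_trans ?_ hE
    obtain ⟨A, -, hA⟩ := hV.decay₀
    have hint : Integrable (fun η => ∑ l, ‖V r η l‖ ^ 2) :=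
      integrable_finsetSum _ fun l _ =>
        integrable_norm_sq_of_hasDecay hV.hK₀ ((hA r).apply l)
          ((continuous_apply l).comp (hV.continuous_slice r)).aestronglyMeasurable
    exact integral_mono_of_nonneg (Eventually.of_forall fun η => sq_nonneg _) hint
      (Eventually.of_forall fun η => norm_sq_le_sum_norm_sq (V r η))
  -- hence the sup bound `M` on `‖ζ‖ < R`
  have hlowR : ∀ s ∈ Icc 0 T, ∀ ζ : EuclideanSpace ℝ (Fin 3), ‖ζ‖ < R → ‖V s ζ‖ ≤ M := by
    intro s hs ζ hζ
    have h1 := norm_le_of_energy hV hE' hs ζ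
    have h2 : ‖V 0 ζ‖ ≤ A₀ := by rw [hV0]; exact hA₀.norm_le ζ
    have h3 : 36 * π * ‖ζ‖ * Λ * s ≤ 36 * π * R * Λ * T₀ :=
      mul_le_mul (by gcongr) (hs.2.trans hT) hs.1 (by positivity)
    rw [hM]
    linarith
  -- the datum's envelope beyond `R'` is `≤ ε/4`
  have hdat : ∀ ξ : EuclideanSpace ℝ (Fin 3), R' ≤ ‖ξ‖ → ‖ξ‖ ^ 2 * ‖V 0 ξ‖ ≤ ε / 4 := by
    intro ξ hξ
    rw [hV0]
    have hn0 : 0 ≤ ‖ξ‖ := norm_nonneg ξ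
    have h1 : (1 + ‖ξ‖) ^ 3 * ‖fourierData hu hd ξ‖ ≤ A₃ := weight_mul_norm_le hA₃ ξ
    have h2' : ‖ξ‖ ^ 2 * R' ≤ (1 + ‖ξ‖) ^ 3 :=
      calc ‖ξ‖ ^ 2 * R' ≤ (1 + ‖ξ‖) ^ 2 * (1 + ‖ξ‖) :=
            mul_le_mul (pow_le_pow_left₀ hn0 (by linarith) 2) (by linarith) hR'0.le
              (by positivity)
        _ = (1 + ‖ξ‖) ^ 3 := by ring
    have h2 : ‖ξ‖ ^ 2 * ‖fourierData hu hd ξ‖ * R' ≤ A₃ :=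
      calc ‖ξ‖ ^ 2 * ‖fourierData hu hd ξ‖ * R' = ‖ξ‖ ^ 2 * R' * ‖fourierData hu hd ξ‖ := by
            ring
        _ ≤ (1 + ‖ξ‖) ^ 3 * ‖fourierData hu hd ξ‖ :=
            mul_le_mul_of_nonneg_right h2' (norm_nonneg _)
        _ ≤ A₃ := h1
    have h3 : A₃ ≤ ε / 4 * R' :=
      calc A₃ = ε / 4 * (4 * A₃ / ε) := by field_simp
        _ ≤ ε / 4 * R' := mul_le_mul_of_nonneg_left hR'₁ (by positivity)
    exact le_of_mul_le_mul_right (h2.trans h3) hR'0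
  exact shell_trapping hV hR0 hR'2R hM0 hε0 hlowR hshell hdat hR'c hεc

end Summit.NavierStokesRegularity.NavierStokesRegularity.Theorems.EnvelopeBound.Registered

end
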